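import Mathlib
import Literature.MathematicalPhysics.QuantumFieldTheory.GaugeOSData
import Literature.MathematicalPhysics.QuantumFieldTheory.LatticeGaugeProofs
import Literature.MathematicalPhysics.QuantumLattice.WilsonBlockHeatBathLightCone2
import HarnessLib

/-!
# `ContinuumLegGivenGap` (stmt-QuantumFields-8782), line `Sketch`: the pair-to-norm upgrade

Support file for the crux item stmt-QuantumFields-8782 (registered stub `stub_pairToNorm` of the
line `Sketch`; skeleton `Cruxes/ContinuumLegGivenGap/Lines/Sketch.lean`).

**Statement** (`stub_pairToNorm` = `BilinearUBP → PairToNorm` of the skeleton, unfolded). Assume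
the abstract uniform boundedness principle for families of continuous bilinear forms on pairs of
real Banach spaces (the first hypothesis; it is the neighbouring stub `stub_bilinearUBP` and is
NOT proved here). Then for a compact gauge group `G`, a lattice representation `r`, a fixed pair
of support boxes `Λ₁, Λ₂ ⊂ edges(ℤ⁴)` and an index family `P ⊆ ℝ × ℕ × ℕ` with weights `w > 0`: if
the torus connected correlations `corr_{β,2S+1}(A, B; n)` (`latticeConnectedCorr`) are bounded
PAIR BY PAIR, `≤ C(A, B) · w(β, S, n)` on `P`, for all gauge-invariant local observables `A`, `B`
with supports `Λ₁`, `Λ₂`, then they are bounded in PRODUCT FORM `≤ K ‖A‖∞ ‖B‖∞ · w(β, S, n)`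
with ONE constant `K = K(Λ₁, Λ₂)`.

**Proof.** (1) Inside the Banach space `ℓ^∞(LGConfig 4 G; ℝ)` (Mathlib `lp _ ⊤`) the measurable
gauge-invariant `Λ`-cylinder observables form a submodule (`exists_obsSubmodule`) which is
closed (`isClosed_of_mem_iff`: `ℓ^∞`-limits are pointwise limits; measurability passes to
sequential pointwise limits, `DependsOn` and gauge invariance to pointwise limits), hence
complete. (2) For each index `(β, S, n)` the connected correlation is a continuous bilinear form
on the pair of these spaces (`exists_corrBilin`): bilinearity is linearity of the integral on
bounded measurable integrands for the probability measure `wilsonMeasure`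
(`latticeConnectedCorr_add_left/right`, `…_smul_left/right`), continuity is the a priori bound
`|corr| ≤ 2 ‖A‖∞ ‖B‖∞` (tree `abs_latticeConnectedCorr_le_two_mul`). (3) A species `A` with
`A.supp = Λ₁` IS a vector of the first space with norm `⨆ U, |A.F U|`, and a vector `x` IS a
species with support `Λ₁` bounded by `‖x‖`; so the pairwise hypothesis is the pointwise
hypothesis of the principle, and its conclusion reads back as the product-form bound.

No definitions, no facts: the Banach spaces and the bilinear forms are produced by existential
theorems. References: Banach–Steinhaus for bilinear families (Rudin, *Functional Analysis*,
Thm. 2.17) enters only through the hypothesis; Osterwalder–Seiler 1978 §2 for the correlations.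
[folklore]
-/

noncomputable section

namespace Summit.QuantumFields.YangMills.Theorems.ContinuumLegGivenGap

open Filter Topology MeasureTheory
open Literature.MathematicalPhysics.QuantumFieldTheory
open Literature.MathematicalPhysics.QuantumLattice

namespace PairToNorm

/-! ### Bilinearity of the connected torus correlation on bounded measurable observables -/

section Measurability

variable {G : Type} [MeasurableSpace G] (S : ℕ)

/-- `U ↦ A(Ũ)` (`Ũ = torusLift S U` the periodic lift) is measurable for measurable `A`.
[folklore] -/
theorem measurable_lift {A : LGConfig 4 G → ℝ} (hA : Measurable A) :
    Measurable fun U : GaugeConfig 4 S G => A (torusLift S U) :=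
  hA.comp (measurable_torusLift S)

/-- `U ↦ A(Ũ) · B(θ_v Ũ)` is measurable for measurable `A`, `B`. [folklore] -/
theorem measurable_lift_mul_shift {A B : LGConfig 4 G → ℝ} (hA : Measurable A)
    (hB : Measurable B) (v : Literature.Probability.LatticeModels.Site 4) :
    Measurable fun U : GaugeConfig 4 S G =>
      A (torusLift S U) * B (configShift v (torusLift S U)) :=
  (measurable_lift S hA).mul
    (hB.comp ((configShift v).measurable.comp (measurable_torusLift S)))

end Measurability

section Bilinear

variable {G : Type} [Group G] [TopologicalSpace G] [IsTopologicalGroup G] [CompactSpace G]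
  [MeasurableSpace G] [BorelSpace G] (r : LatticeRep G) (β : ℝ) (S : ℕ) [NeZero S]

/-- A bounded measurable function of the torus gauge field is integrable for the torus Wilson
state `wilsonMeasure r.ρ β` (a probability measure for continuous `ρ`). [folklore] -/
theorem integrable_wilsonMeasure {F : GaugeConfig 4 S G → ℝ} (hF : Measurable F) {C : ℝ}
    (hC : ∀ U, |F U| ≤ C) : Integrable F (wilsonMeasure (d := 4) (L := S) r.ρ β) := by
  haveI := isProbabilityMeasure_wilsonMeasure (d := 4) (L := S) r.ρ r.continuous β
  exact Integrable.of_bound hF.aestronglyMeasurable C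
    (Eventually.of_forall fun U => by rw [Real.norm_eq_abs]; exact hC U)

/-- Integrability of `U ↦ A(Ũ)` for bounded measurable `A`. [folklore] -/
theorem integrable_lift {A : LGConfig 4 G → ℝ} (hA : Measurable A) {C : ℝ}
    (hC : ∀ U, |A U| ≤ C) :
    Integrable (fun U => A (torusLift S U)) (wilsonMeasure (d := 4) (L := S) r.ρ β) :=
  integrable_wilsonMeasure r β S (measurable_lift S hA) fun _ => hC _

/-- Integrability of `U ↦ A(Ũ) B(θ_v Ũ)` for bounded measurable `A`, `B`. [folklore] -/
theorem integrable_lift_mul_shift {A B : LGConfig 4 G → ℝ} (hA : Measurable A)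
    (hB : Measurable B) {CA CB : ℝ} (hCA : ∀ U, |A U| ≤ CA) (hCB : ∀ U, |B U| ≤ CB)
    (v : Literature.Probability.LatticeModels.Site 4) :
    Integrable (fun U => A (torusLift S U) * B (configShift v (torusLift S U)))
      (wilsonMeasure (d := 4) (L := S) r.ρ β) := by
  have hCA0 : 0 ≤ CA := le_trans (abs_nonneg _) (hCA fun _ => 1)
  refine integrable_wilsonMeasure r β S (C := CA * CB) (measurable_lift_mul_shift S hA hB v)
    fun U => ?_
  rw [abs_mul]
  exact mul_le_mul (hCA _) (hCB _) (abs_nonneg _) hCA0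

/-- Additivity of the connected torus correlation in the first observable (bounded measurable
observables). [folklore] -/
theorem latticeConnectedCorr_add_left {A₁ A₂ B : LGConfig 4 G → ℝ} (h₁ : Measurable A₁)
    (h₂ : Measurable A₂) (hB : Measurable B) {C₁ C₂ CB : ℝ} (hC₁ : ∀ U, |A₁ U| ≤ C₁)
    (hC₂ : ∀ U, |A₂ U| ≤ C₂) (hCB : ∀ U, |B U| ≤ CB) (n : ℕ) :
    latticeConnectedCorr r.ρ β S (A₁ + A₂) B n =
      latticeConnectedCorr r.ρ β S A₁ B n + latticeConnectedCorr r.ρ β S A₂ B n := by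
  have i₁ := integrable_lift r β S h₁ hC₁
  have i₂ := integrable_lift r β S h₂ hC₂
  have j₁ := integrable_lift_mul_shift r β S h₁ hB hC₁ hCB (-Pi.single 0 (n : ℤ))
  have j₂ := integrable_lift_mul_shift r β S h₂ hB hC₂ hCB (-Pi.single 0 (n : ℤ))
  unfold latticeConnectedCorr
  simp only [Pi.add_apply, add_mul]
  rw [integral_add j₁ j₂, integral_add i₁ i₂]
  ring

/-- Additivity of the connected torus correlation in the second observable (bounded measurable
observables). [folklore] -/
theorem latticeConnectedCorr_add_right {A B₁ B₂ : LGConfig 4 G → ℝ} (hA : Measurable A)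
    (h₁ : Measurable B₁) (h₂ : Measurable B₂) {CA C₁ C₂ : ℝ} (hCA : ∀ U, |A U| ≤ CA)
    (hC₁ : ∀ U, |B₁ U| ≤ C₁) (hC₂ : ∀ U, |B₂ U| ≤ C₂) (n : ℕ) :
    latticeConnectedCorr r.ρ β S A (B₁ + B₂) n =
      latticeConnectedCorr r.ρ β S A B₁ n + latticeConnectedCorr r.ρ β S A B₂ n := by
  have i₁ := integrable_lift r β S h₁ hC₁
  have i₂ := integrable_lift r β S h₂ hC₂
  have j₁ := integrable_lift_mul_shift r β S hA h₁ hCA hC₁ (-Pi.single 0 (n : ℤ))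
  have j₂ := integrable_lift_mul_shift r β S hA h₂ hCA hC₂ (-Pi.single 0 (n : ℤ))
  unfold latticeConnectedCorr
  simp only [Pi.add_apply, mul_add]
  rw [integral_add j₁ j₂, integral_add i₁ i₂]
  ring

/-- Homogeneity of the connected torus correlation in the first observable. [folklore] -/
theorem latticeConnectedCorr_smul_left {N : ℕ} (ρ : G →* Matrix (Fin N) (Fin N) ℂ) (c : ℝ)
    (A B : LGConfig 4 G → ℝ) (n : ℕ) :
    latticeConnectedCorr ρ β S (c • A) B n = c * latticeConnectedCorr ρ β S A B n := by
  -- adapted from `…LatticeGapInUVUnits.Negative.latticeConnectedCorr_smul` (tree)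
  unfold latticeConnectedCorr
  have h1 : (fun U : GaugeConfig 4 S G =>
      (c • A) (torusLift S U) * B (configShift (-Pi.single 0 (n : ℤ)) (torusLift S U))) =
      fun U => c * (A (torusLift S U) *
        B (configShift (-Pi.single 0 (n : ℤ)) (torusLift S U))) := by
    funext U; simp only [Pi.smul_apply, smul_eq_mul]; ring
  have h2 : (fun U : GaugeConfig 4 S G => (c • A) (torusLift S U)) =
      fun U => c * A (torusLift S U) := by
    funext U; simp only [Pi.smul_apply, smul_eq_mul]
  rw [h1, h2, integral_const_mul, integral_const_mul]
  ring

/-- Homogeneity of the connected torus correlation in the second observable. [folklore] -/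
theorem latticeConnectedCorr_smul_right {N : ℕ} (ρ : G →* Matrix (Fin N) (Fin N) ℂ) (c : ℝ)
    (A B : LGConfig 4 G → ℝ) (n : ℕ) :
    latticeConnectedCorr ρ β S A (c • B) n = c * latticeConnectedCorr ρ β S A B n := by
  -- adapted from `…LatticeGapInUVUnits.Negative.latticeConnectedCorr_smul` (tree)
  unfold latticeConnectedCorr
  have h1 : (fun U : GaugeConfig 4 S G =>
      A (torusLift S U) * (c • B) (configShift (-Pi.single 0 (n : ℤ)) (torusLift S U))) =
      fun U => c * (A (torusLift S U) *
        B (configShift (-Pi.single 0 (n : ℤ)) (torusLift S U))) := by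
    funext U; simp only [Pi.smul_apply, smul_eq_mul]; ring
  have h2 : (fun U : GaugeConfig 4 S G => (c • B) (torusLift S U)) =
      fun U => c * B (torusLift S U) := by
    funext U; simp only [Pi.smul_apply, smul_eq_mul]
  rw [h1, h2, integral_const_mul, integral_const_mul]
  ring

end Bilinear

/-! ### The Banach space of bounded measurable gauge-invariant `Λ`-cylinder observables -/

section Space

variable {G : Type} [Group G] [MeasurableSpace G]

/-- The measurable gauge-invariant `Λ`-cylinder observables form a submodule of
`ℓ^∞(LGConfig 4 G; ℝ)`. [folklore] -/
theorem exists_obsSubmodule (Λ : Finset (Literature.MathematicalPhysics.QuantumLattice.ZdEdge 4)) :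
    ∃ W : Submodule ℝ (lp (fun _ : LGConfig 4 G => ℝ) ⊤), ∀ f : lp (fun _ : LGConfig 4 G => ℝ) ⊤,
      f ∈ W ↔ Measurable (f : LGConfig 4 G → ℝ) ∧ IsCylinder (f : LGConfig 4 G → ℝ) Λ ∧
        IsZdGaugeInvariant (f : LGConfig 4 G → ℝ) := by
  refine ⟨{ carrier := {f | Measurable (f : LGConfig 4 G → ℝ) ∧
                IsCylinder (f : LGConfig 4 G → ℝ) Λ ∧ IsZdGaugeInvariant (f : LGConfig 4 G → ℝ)}
            add_mem' := ?_
            zero_mem' := ⟨measurable_const, fun _ _ _ => rfl, fun _ _ => rfl⟩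
            smul_mem' := ?_ }, fun f => Iff.rfl⟩
  · rintro a b ⟨ham, hac, hag⟩ ⟨hbm, hbc, hbg⟩
    refine ⟨ham.add hbm, fun U V hUV => ?_, fun g U => ?_⟩
    · simp only [lp.coeFn_add, Pi.add_apply]
      rw [hac hUV, hbc hUV]
    · simp only [lp.coeFn_add, Pi.add_apply]
      rw [hag g U, hbg g U]
  · rintro c a ⟨ham, hac, hag⟩
    refine ⟨ham.const_smul c, fun U V hUV => ?_, fun g U => ?_⟩
    · simp only [lp.coeFn_smul, Pi.smul_apply]
      rw [hac hUV]
    · simp only [lp.coeFn_smul, Pi.smul_apply]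
      rw [hag g U]

/-- Such a submodule is closed in `ℓ^∞`: norm convergence implies pointwise convergence,
sequential pointwise limits of measurable functions are measurable, and pointwise limits of
`Λ`-cylinder, resp. gauge-invariant, functions are `Λ`-cylinder, resp. gauge invariant.
[folklore] -/
theorem isClosed_of_mem_iff {Λ : Finset (Literature.MathematicalPhysics.QuantumLattice.ZdEdge 4)}
    (W : Submodule ℝ (lp (fun _ : LGConfig 4 G => ℝ) ⊤))
    (hW : ∀ f : lp (fun _ : LGConfig 4 G => ℝ) ⊤, f ∈ W ↔ Measurable (f : LGConfig 4 G → ℝ) ∧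
      IsCylinder (f : LGConfig 4 G → ℝ) Λ ∧ IsZdGaugeInvariant (f : LGConfig 4 G → ℝ)) :
    IsClosed (W : Set (lp (fun _ : LGConfig 4 G => ℝ) ⊤)) := by
  refine IsSeqClosed.isClosed fun x f hx hfx => ?_
  have hx' := fun n => (hW _).1 (hx n)
  have hpt : Tendsto (fun n => ((x n : lp (fun _ : LGConfig 4 G => ℝ) ⊤) : LGConfig 4 G → ℝ))
      atTop (𝓝 (f : LGConfig 4 G → ℝ)) :=
    ((lp.uniformContinuous_coe (E := fun _ : LGConfig 4 G => ℝ) (p := ⊤)).continuous.tendsto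
      f).comp hfx
  have hev : ∀ U, Tendsto (fun n => (x n : LGConfig 4 G → ℝ) U) atTop
      (𝓝 ((f : LGConfig 4 G → ℝ) U)) := fun U => hpt.apply_nhds U
  refine (hW f).2 ⟨measurable_of_tendsto_metrizable (fun n => (hx' n).1) hpt,
    fun U V hUV => ?_, fun g U => ?_⟩
  · have h := hev U
    rw [show (fun n => (x n : LGConfig 4 G → ℝ) U) = fun n => (x n : LGConfig 4 G → ℝ) V from
      funext fun n => (hx' n).2.1 hUV] at h
    exact tendsto_nhds_unique h (hev V)
  · have h := hev (gaugeTransformZd g U)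
    rw [show (fun n => (x n : LGConfig 4 G → ℝ) (gaugeTransformZd g U)) =
        fun n => (x n : LGConfig 4 G → ℝ) U from funext fun n => (hx' n).2.2 g U] at h
    exact tendsto_nhds_unique h (hev U)

omit [Group G] [MeasurableSpace G] in
/-- The sup norm dominates every value: `|x U| ≤ ‖x‖` on a submodule of `ℓ^∞`. [folklore] -/
theorem abs_apply_le_norm {W : Submodule ℝ (lp (fun _ : LGConfig 4 G => ℝ) ⊤)} (x : W)
    (U : LGConfig 4 G) :
    |((x : lp (fun _ : LGConfig 4 G => ℝ) ⊤) : LGConfig 4 G → ℝ) U| ≤ ‖x‖ :=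
  lp.norm_apply_le_norm ENNReal.top_ne_zero (x : lp (fun _ : LGConfig 4 G => ℝ) ⊤) U

omit [Group G] [MeasurableSpace G] in
/-- A bounded function is a vector of `ℓ^∞`. [folklore] -/
theorem memℓp_of_abs_le {F : LGConfig 4 G → ℝ} {C : ℝ} (hC : ∀ U, |F U| ≤ C) :
    Memℓp (E := fun _ : LGConfig 4 G => ℝ) F ⊤ :=
  memℓp_infty ⟨C, by rintro _ ⟨U, rfl⟩; exact hC U⟩

omit [Group G] [MeasurableSpace G] in
/-- The norm of the vector of a submodule of `ℓ^∞` given by a bounded function `F` is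
`⨆ U, |F U|`. [folklore] -/
theorem norm_mk_eq_iSup {W : Submodule ℝ (lp (fun _ : LGConfig 4 G => ℝ) ⊤)}
    (F : LGConfig 4 G → ℝ) (hF : Memℓp (E := fun _ : LGConfig 4 G => ℝ) F ⊤)
    (hW : (⟨F, hF⟩ : lp (fun _ : LGConfig 4 G => ℝ) ⊤) ∈ W) :
    ‖(⟨⟨F, hF⟩, hW⟩ : W)‖ = ⨆ U, |F U| := by
  rw [Submodule.coe_norm, lp.norm_eq_ciSup]
  rfl

end Space

/-! ### The connected correlation as a continuous bilinear form -/

section Form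

variable {G : Type} [Group G] [TopologicalSpace G] [IsTopologicalGroup G] [CompactSpace G]
  [MeasurableSpace G] [BorelSpace G]

/-- On a pair of submodules of `ℓ^∞` consisting of measurable functions the connected torus
correlation `(x, y) ↦ corr_{β,S}(x, y; n)` is a continuous bilinear form (bound `2 ‖x‖ ‖y‖`).
[folklore] -/
theorem exists_corrBilin (r : LatticeRep G)
    {W₁ W₂ : Submodule ℝ (lp (fun _ : LGConfig 4 G => ℝ) ⊤)}
    (hW₁ : ∀ f ∈ W₁, Measurable (f : LGConfig 4 G → ℝ))
    (hW₂ : ∀ f ∈ W₂, Measurable (f : LGConfig 4 G → ℝ)) (β : ℝ) (S : ℕ) [NeZero S] (n : ℕ) :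
    ∃ b : W₁ →L[ℝ] W₂ →L[ℝ] ℝ, ∀ (x : W₁) (y : W₂), b x y =
      latticeConnectedCorr r.ρ β S ((x : lp (fun _ : LGConfig 4 G => ℝ) ⊤) : LGConfig 4 G → ℝ)
        ((y : lp (fun _ : LGConfig 4 G => ℝ) ⊤) : LGConfig 4 G → ℝ) n := by
  refine ⟨LinearMap.mkContinuous₂ (LinearMap.mk₂ ℝ
    (fun (x : W₁) (y : W₂) => latticeConnectedCorr r.ρ β S
      ((x : lp (fun _ : LGConfig 4 G => ℝ) ⊤) : LGConfig 4 G → ℝ)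
      ((y : lp (fun _ : LGConfig 4 G => ℝ) ⊤) : LGConfig 4 G → ℝ) n) ?_ ?_ ?_ ?_) 2 ?_,
    fun x y => rfl⟩
  · exact fun x₁ x₂ y => latticeConnectedCorr_add_left r β S (hW₁ _ x₁.2) (hW₁ _ x₂.2)
      (hW₂ _ y.2) (abs_apply_le_norm x₁) (abs_apply_le_norm x₂) (abs_apply_le_norm y) n
  · exact fun c x y => latticeConnectedCorr_smul_left β S r.ρ c _ _ n
  · exact fun x y₁ y₂ => latticeConnectedCorr_add_right r β S (hW₁ _ x.2) (hW₂ _ y₁.2)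
      (hW₂ _ y₂.2) (abs_apply_le_norm x) (abs_apply_le_norm y₁) (abs_apply_le_norm y₂) n
  · exact fun c x y => latticeConnectedCorr_smul_right β S r.ρ c _ _ n
  · intro x y
    rw [LinearMap.mk₂_apply, Real.norm_eq_abs, mul_assoc]
    exact WilsonBlockHeatBath.abs_latticeConnectedCorr_le_two_mul r β S (abs_apply_le_norm x)
      (abs_apply_le_norm y) n

end Form

end PairToNorm

/-- **Pair-to-norm upgrade** (registered stub `stub_pairToNorm` of stmt-8782, line `Sketch`;
`BilinearUBP → PairToNorm` of the skeleton): GIVEN the uniform boundedness principle for families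
of continuous bilinear forms on real Banach spaces (first hypothesis), for a fixed pair of
support boxes `Λ₁, Λ₂` a family of torus connected correlations (indices `(β, S, n)` selected
by `P`, weights `w > 0`) that is bounded PAIR BY PAIR, `≤ C(A, B) · w`, is bounded in PRODUCT
FORM `≤ K ‖A‖∞ ‖B‖∞ · w` with ONE constant for the box pair — the principle instantiated on the
Banach spaces of bounded measurable gauge-invariant `Λᵢ`-cylinder observables with the sup norm
(closed subspaces of `ℓ^∞`), on which `(A, B) ↦ corr_{β,2S+1}(A, B; n)` is a continuous
bilinear form (`|corr| ≤ 2 ‖A‖∞ ‖B‖∞`). [folklore] -/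
theorem stub_pairToNorm :
    (∀ (X Y : Type) [NormedAddCommGroup X] [NormedSpace ℝ X] [CompleteSpace X]
      [NormedAddCommGroup Y] [NormedSpace ℝ Y] [CompleteSpace Y] (ι : Type)
      (b : ι → X →L[ℝ] Y →L[ℝ] ℝ) (w : ι → ℝ), (∀ i, 0 < w i) →
      (∀ x y, ∃ C : ℝ, ∀ i, |b i x y| ≤ C * w i) →
        ∃ K : ℝ, ∀ i x y, |b i x y| ≤ K * ‖x‖ * ‖y‖ * w i) →
    ∀ (G : Type) [Group G] [TopologicalSpace G] [IsTopologicalGroup G] [CompactSpace G]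
      [MeasurableSpace G] [BorelSpace G] (r : LatticeRep G)
      (Λ₁ Λ₂ : Finset (Literature.MathematicalPhysics.QuantumLattice.ZdEdge 4))
      (P : ℝ → ℕ → ℕ → Prop) (w : ℝ → ℕ → ℕ → ℝ), (∀ β S n, P β S n → 0 < w β S n) →
      (∀ A B : YMSpecies G, A.supp = Λ₁ → B.supp = Λ₂ → ∃ C : ℝ, ∀ β S n, P β S n →
          |latticeConnectedCorr r.ρ β (2 * S + 1) A.F B.F n| ≤ C * w β S n) →
        ∃ K : ℝ, ∀ A B : YMSpecies G, A.supp = Λ₁ → B.supp = Λ₂ → ∀ β S n, P β S n →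
          |latticeConnectedCorr r.ρ β (2 * S + 1) A.F B.F n| ≤
            K * (⨆ U, |A.F U|) * (⨆ U, |B.F U|) * w β S n := by
  intro hUBP G _ _ _ _ _ _ r Λ₁ Λ₂ P w hw hpair
  obtain ⟨W₁, hW₁⟩ := PairToNorm.exists_obsSubmodule (G := G) Λ₁
  obtain ⟨W₂, hW₂⟩ := PairToNorm.exists_obsSubmodule (G := G) Λ₂
  haveI : CompleteSpace W₁ :=
    (PairToNorm.isClosed_of_mem_iff W₁ hW₁).isComplete.completeSpace_coe
  haveI : CompleteSpace W₂ :=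
    (PairToNorm.isClosed_of_mem_iff W₂ hW₂).isComplete.completeSpace_coe
  have hm₁ : ∀ f ∈ W₁, Measurable (f : LGConfig 4 G → ℝ) := fun f hf => ((hW₁ f).1 hf).1
  have hm₂ : ∀ f ∈ W₂, Measurable (f : LGConfig 4 G → ℝ) := fun f hf => ((hW₂ f).1 hf).1
  -- one continuous bilinear form per selected index `(β, S, n)`
  choose b hb using fun i : {i : ℝ × ℕ × ℕ // P i.1 i.2.1 i.2.2} =>
    PairToNorm.exists_corrBilin r hm₁ hm₂ i.1.1 (2 * i.1.2.1 + 1) i.1.2.2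
  obtain ⟨K, hK⟩ := hUBP W₁ W₂ {i : ℝ × ℕ × ℕ // P i.1 i.2.1 i.2.2} b
    (fun i => w i.1.1 i.1.2.1 i.1.2.2) (fun i => hw _ _ _ i.2) fun x y => by
      -- the vectors `x`, `y` ARE species with supports `Λ₁`, `Λ₂`, bounded by their norms
      obtain ⟨hxm, hxc, hxg⟩ := (hW₁ _).1 x.2
      obtain ⟨hym, hyc, hyg⟩ := (hW₂ _).1 y.2
      obtain ⟨C, hC⟩ := hpair
        ⟨((x : lp (fun _ : LGConfig 4 G => ℝ) ⊤) : LGConfig 4 G → ℝ), Λ₁, hxc, hxg,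
          ⟨‖x‖, PairToNorm.abs_apply_le_norm x⟩, hxm⟩
        ⟨((y : lp (fun _ : LGConfig 4 G => ℝ) ⊤) : LGConfig 4 G → ℝ), Λ₂, hyc, hyg,
          ⟨‖y‖, PairToNorm.abs_apply_le_norm y⟩, hym⟩ rfl rfl
      exact ⟨C, fun i => by rw [hb]; exact hC _ _ _ i.2⟩
  refine ⟨K, fun A B hA hB β S n hP => ?_⟩
  -- the species `A`, `B` ARE vectors, with norms `⨆ |A.F|`, `⨆ |B.F|`
  obtain ⟨CA, hCA⟩ := A.bounded
  obtain ⟨CB, hCB⟩ := B.bounded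
  have mA := PairToNorm.memℓp_of_abs_le hCA
  have mB := PairToNorm.memℓp_of_abs_le hCB
  have eA : (⟨A.F, mA⟩ : lp (fun _ : LGConfig 4 G => ℝ) ⊤) ∈ W₁ :=
    (hW₁ _).2 ⟨A.measurable, hA ▸ A.isCylinder, A.gaugeInvariant⟩
  have eB : (⟨B.F, mB⟩ : lp (fun _ : LGConfig 4 G => ℝ) ⊤) ∈ W₂ :=
    (hW₂ _).2 ⟨B.measurable, hB ▸ B.isCylinder, B.gaugeInvariant⟩
  have h := hK ⟨(β, S, n), hP⟩ ⟨⟨A.F, mA⟩, eA⟩ ⟨⟨B.F, mB⟩, eB⟩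
  rw [hb, PairToNorm.norm_mk_eq_iSup A.F mA eA, PairToNorm.norm_mk_eq_iSup B.F mB eB] at h
  exact h

end Summit.QuantumFields.YangMills.Theorems.ContinuumLegGivenGap

end
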